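import Summits.KontsevichZagierPeriods.KontsevichZagierPeriods.Theses.LinRedNormalForm
import Literature.NumberTheory.Transcendental.MultipleZetaWeightFiveProofs
import Literature.NumberTheory.Transcendental.MultipleZetaRepeatedTwosProofs
import Literature.NumberTheory.Transcendental.LindemannWeierstrassProofs

/-!
# Crux `HoffmanIndependence` (stmt-KontsevichZagierPeriods-15045) — the provable diagonal and the
# first open slice

Disprover output (cdisprove cycle 1; workfile `Cruxes/HoffmanIndependence/Disproof.lean`, §B–§C).

* `hoffmanIndependence_diagonal` — the sub-family `u ∈ {2}^×` of the crux IS `ℚ`-linearly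
  independent: `ζ({2}ⁿ) = π²ⁿ/(2n+1)!` (`multipleZeta_replicate_two`) and `π` is transcendental
  (Lindemann, `transcendental_pi_holds`, proved in the tree). This is the largest sub-family the
  tree's transcendence input reaches; the first open pairs are `{[2],[3]}` (`ζ(3)/π² ∉ ℚ`) and the
  weight-5 slice below.
* `zeta_five_ne_of_hoffmanIndependence` — the crux implies `ζ(5) ∉ ℚ·ζ(2)ζ(3)` (open; not even
  `ζ(5) ∉ ℚ` is known), through the weight-5 double-shuffle evaluations of `ζ(2,3)`, `ζ(3,2)`
  (tree theorems). A Lean-checked instance of "the crux has Zagier-conjecture strength".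
-/

namespace Summit.KontsevichZagierPeriods.HoffmanIndependence.Negative

open scoped Nat
open Literature.NumberTheory.Transcendental MZV
open Summit.KontsevichZagierPeriods.KontsevichZagierPeriods.Theses.LinRedNormalForm (HoffmanIndependence)

/-- The powers of a transcendental element are linearly independent (a vanishing combination is a
polynomial annihilating `t`). [folklore] -/
theorem linearIndependent_pow_of_transcendental {F E : Type*} [CommRing F] [Ring E]
    [Algebra F E] {t : E} (ht : Transcendental F t) :
    LinearIndependent F (fun n : ℕ => t ^ n) := by
  classical
  rw [linearIndependent_iff']
  intro s g hsum n hn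
  let p : Polynomial F := ∑ i ∈ s, Polynomial.monomial i (g i)
  have hp : Polynomial.aeval t p = 0 := by
    simp only [p, map_sum, Polynomial.aeval_monomial, ← Algebra.smul_def]
    exact hsum
  have hp0 : p = 0 := by
    by_contra h
    exact ht ⟨p, h, hp⟩
  have hcoeff : p.coeff n = g n := by
    simp only [p, Polynomial.finsetSum_coeff, Polynomial.coeff_monomial]
    rw [Finset.sum_ite_eq' s n g]
    simp [hn]
  rw [← hcoeff, hp0, Polynomial.coeff_zero]

/-- **The diagonal `{2}^×` of `HoffmanIndependence` is a theorem**: the values `ζ(2,…,2)` (`n` twos,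
`n ≥ 0`, `ζ(∅) = 1`) are `ℚ`-linearly independent — they are non-zero rational multiples of the
distinct even powers `π²ⁿ` of the transcendental number `π`. [cite: Hoffman1992, Corollary 2.3] -/
theorem hoffmanIndependence_diagonal :
    LinearIndependent ℚ (fun n : ℕ => multipleZeta (List.replicate n 2)) := by
  have hpow : LinearIndependent ℚ (fun m : ℕ => Real.pi ^ m) :=
    linearIndependent_pow_of_transcendental transcendental_pi_holds
  have heven : LinearIndependent ℚ (fun n : ℕ => Real.pi ^ (2 * n)) :=
    hpow.comp (fun n : ℕ => 2 * n) (fun a b hab => by simpa using hab)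
  have hunits := heven.units_smul (fun n => Units.mk0 (((2 * n + 1)! : ℕ) : ℚ)⁻¹
    (inv_ne_zero (by positivity)))
  convert hunits using 1
  funext n
  simp only [Pi.smul_apply', Units.smul_def, Units.val_mk0, multipleZeta_replicate_two, Rat.smul_def]
  push_cast
  ring

/-- **`HoffmanIndependence` implies `ζ(5) ∉ ℚ·ζ(2)ζ(3)`** (open): with
`ζ(2,3) = (9/2)ζ(5) - 2ζ(2)ζ(3)` and `ζ(3,2) = 3ζ(2)ζ(3) - (11/2)ζ(5)` (tree theorems
`multipleZeta_two_three_eq`, `multipleZeta_three_two_eq`), a relation `ζ(5) = q·ζ(2)ζ(3)` makes the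
weight-5 Hoffman values `ζ(2,3)`, `ζ(3,2)` proportional, contradicting the crux on the pair
`{[2,3],[3,2]}` (the coefficients `3 - 11q/2`, `9q/2 - 2` do not vanish together).
[cite: Zagier1994, §9] -/
theorem zeta_five_ne_of_hoffmanIndependence (h : HoffmanIndependence) (q : ℚ) :
    multipleZeta [5] ≠ (q : ℝ) * (multipleZeta [2] * multipleZeta [3]) := by
  intro h5
  have h' : LinearIndependent ℚ (fun u : {u : List ℕ // IsHoffman u} => multipleZeta u.1) := h
  rw [linearIndependent_iff'] at h'
  let a : {u : List ℕ // IsHoffman u} := ⟨[2, 3], by decide⟩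
  let b : {u : List ℕ // IsHoffman u} := ⟨[3, 2], by decide⟩
  have hab : a ≠ b := by simp [a, b]
  set P := multipleZeta [2] * multipleZeta [3] with hP
  have h23 : multipleZeta [2, 3] = ((9 / 2 * q - 2 : ℚ) : ℝ) * P := by
    rw [multipleZeta_two_three_eq, h5]; push_cast; ring
  have h32 : multipleZeta [3, 2] = ((3 - 11 / 2 * q : ℚ) : ℝ) * P := by
    rw [multipleZeta_three_two_eq, h5]; push_cast; ring
  have key := h' {a, b} (fun u => if u = a then 3 - 11 / 2 * q else -(9 / 2 * q - 2)) ?_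
  · have ha := key a (by simp)
    have hb := key b (by simp)
    rw [if_pos rfl] at ha
    rw [if_neg hab.symm] at hb
    linarith
  · rw [Finset.sum_pair hab, if_pos rfl, if_neg hab.symm]
    show ((3 - 11 / 2 * q : ℚ)) • multipleZeta [2, 3] + (-(9 / 2 * q - 2) : ℚ) • multipleZeta [3, 2] = 0
    rw [h23, h32, Rat.smul_def, Rat.smul_def]
    push_cast
    ring

end Summit.KontsevichZagierPeriods.HoffmanIndependence.Negative
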